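import Literature.Barriers.CriticalPhenomena.GridSAWGridFormulaGraphExplicit
import HarnessLib

/-!
# The grid graph of a formula has maximum degree three

For the grid drawing of `Literature.Combinatorics.SimpleGraph.GridFormula.graphOf ψ`
(Liśkiewicz–Ogihara–Toda 2003, Lemma 4 / Theorem 7; tree fact `GridSAW.LOT2003_lemma4_gadgets`)
every vertex must have at most three drawn edges. This is a property of the abstract graph:

* **`length_le_three_of_adj`** — any list of distinct neighbours of a vertex of `graphOf ψ` has
  at most three members: a gadget vertex has its (at most three) template neighbours; a connector
  has the entry corner of its cell and the exit corner of the previous one; a cell vertex has its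
  cell neighbours, its connector if it is a corner (cell-degree two then), and, for every gadget
  entered through it, ONE rail node in exchange for the other end of the slot, which is no longer
  a neighbour (an injection into the at most three chain neighbours).

## References

* M. Liśkiewicz, M. Ogihara, S. Toda, TCS 304 (2003) 129–156, §4 (proof of Theorem 7: "the
  maximum degree of the graphs … is three, there will be no vertex congestion").
-/

namespace Literature.Barriers.CriticalPhenomena.GridSAW

namespace GridFormulaFP

open Literature.Computability.Complexity (CNF)
open Literature.Combinatorics.SimpleGraph Literature.Combinatorics.SimpleGraph.GridFormula
open Literature.Combinatorics.SimpleGraph.GridCell (CellTy conn vtx chainG chainVerts cellTy)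
open Literature.Combinatorics.SimpleGraph.RailV

/-! ### Neighbours inside a rail gadget -/

section Rail

variable {k K m : ℕ} (Γ : RailGadget k K m)

/-- The (at most three) candidate neighbours of an inner vertex of a rail gadget. [folklore] -/
def nbrsV : RailV k K m → List (RailV k K m)
  | node x =>
    [mid (Γ.rungOf x)] ++
      (if h : x.2.val + 1 < K then [node (x.1, ⟨x.2.val + 1, h⟩)] else [port x.1 false]) ++
      (if h : 0 < x.2.val then [node (x.1, ⟨x.2.val - 1, by omega⟩)] else [port x.1 true])
  | mid ρ => [node (Γ.fst ρ), node (Γ.snd ρ)]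
  | port _ _ => []

/-- The candidate list has at most three members. [folklore] -/
theorem length_nbrsV_le (u : RailV k K m) : (nbrsV Γ u).length ≤ 3 := by
  cases u with
  | node x => simp only [nbrsV]; split_ifs <;> simp
  | mid ρ => simp [nbrsV]
  | port r t => simp [nbrsV]

/-- **Every neighbour of an inner vertex is a candidate.** [folklore] -/
theorem mem_nbrsV_of_adj {u w : RailV k K m} (hu : isInner u = true) (h : Γ.graph.Adj u w) : w ∈ nbrsV Γ u := by
  cases u with
  | node x =>
    rcases Γ.adj_node_iff.1 h with rfl | ⟨x', rfl, h1, h2 | h2⟩ | ⟨rfl, h0⟩ | ⟨rfl, hK⟩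
    · simp [nbrsV]
    · have hlt : x.2.val + 1 < K := by have := x'.2.isLt; omega
      have : x' = (x.1, ⟨x.2.val + 1, hlt⟩) := Prod.ext h1 (Fin.ext (by simp; omega))
      subst this
      simp [nbrsV, hlt]
    · have hpos : 0 < x.2.val := by omega
      have hlt' : x.2.val - 1 < K := by have := x.2.isLt; omega
      have : x' = (x.1, ⟨x.2.val - 1, hlt'⟩) := Prod.ext h1 (Fin.ext (by simp; omega))
      subst this
      simp only [nbrsV, List.mem_append, List.mem_singleton, dif_pos hpos, or_true]
    · have : ¬ 0 < x.2.val := by omega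
      simp only [nbrsV, List.mem_append, List.mem_singleton, dif_neg this, or_true]
    · have : ¬ x.2.val + 1 < K := by omega
      simp only [nbrsV, List.mem_append, List.mem_singleton, dif_neg this, true_or, or_true]
  | mid ρ =>
    rcases Γ.adj_mid_iff.1 h with rfl | rfl <;> simp [nbrsV]
  | port r t => simp [isInner] at hu

end Rail

variable (ψ : CNF ℕ)

/-! ### The three kinds of vertices -/

/-- **A gadget vertex has at most three neighbours** (all inside its gadget). [folklore] -/
theorem length_le_three_of_adj_VX {g v : ℕ} (hg : g < ngadgets ψ) (hv : v ∈ (family ψ).VX g)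
    {l : List ℕ} (hl : l.Nodup) (h : ∀ w ∈ l, (graphOf ψ).Adj v w) : l.length ≤ 3 := by
  have hvalid := valid ψ (ngadgets ψ)
  -- every neighbour is a neighbour in the gadget graph of `g`
  have hGX : ∀ w ∈ l, ((family ψ).GX g).Adj v w := by
    intro w hw
    have hadj := h w hw
    change (GadgetFamily.graphUpTo (chainG (cellsOf ψ)) (chainVerts (cellsOf ψ)) (family ψ) (ngadgets ψ)).Adj v w at hadj
    rcases hadj with ⟨-, hvV, -, -⟩ | ⟨g', hg', hadj'⟩
    · exact absurd hv (Finset.disjoint_left.1 (hvalid.V_disjoint g hg) hvV)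
    · by_cases hgg : g' = g
      · subst hgg; exact hadj'
      · exfalso
        obtain ⟨-, hv', -⟩ := hvalid.gadget_adj g' hg' v w hadj'
        rcases hv' with hv' | hv'
        · exact Finset.disjoint_left.1 (hvalid.VX_disjoint g hg g' hg' (Ne.symm hgg)) hv hv'
        · exact Finset.disjoint_left.1 (hvalid.V_disjoint g hg) (hvalid.ports_subset hg' hv') hv
  -- inside the placed gadget, pull back to the template
  rw [family_VX] at hv
  cases hP : place ψ g with
  | none => rw [hP] at hv; simp at hv
  | some P =>
    rw [hP] at hv
    obtain ⟨u, hu, rfl⟩ := Finset.mem_map.1 hv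
    have huin : isInner u = true := P.Γ.mem_VX_iff.1 hu
    -- each neighbour is the image of a template neighbour of `u`
    have hpre : ∀ w ∈ l, ∃ w', w = P.emb w' ∧ P.Γ.graph.Adj u w' := by
      intro w hw
      have hadj := hGX w hw
      rw [family_GX, hP] at hadj
      change (P.Γ.graph.map P.emb).Adj (P.emb u) w at hadj
      rw [_root_.SimpleGraph.map_adj] at hadj
      obtain ⟨u', w', huw, hu', rfl⟩ := hadj
      rw [P.emb.injective hu'] at huw
      exact ⟨w', rfl, huw⟩
    -- so `l` is a list of distinct images of candidates
    have hsub : ∀ w ∈ l, w ∈ (nbrsV P.Γ u).map P.emb := by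
      intro w hw
      obtain ⟨w', rfl, hadj⟩ := hpre w hw
      exact List.mem_map_of_mem (mem_nbrsV_of_adj P.Γ huin hadj)
    exact ((List.subperm_of_subset hl hsub).length_le).trans (by rw [List.length_map]; exact length_nbrsV_le P.Γ u)

/-- A port of a gadget is a block vertex of a cell (never a connector). [folklore] -/
theorem exists_eq_vtx_of_mem_ports {g p : ℕ} (hp : p ∈ ports ((family ψ).S g)) : ∃ kc a, p = vtx kc a := by
  obtain ⟨e, he, h⟩ := mem_ports_iff.1 hp
  obtain ⟨kc, e₀, rfl, -⟩ := mem_S_spec ψ he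
  rcases h with rfl | rfl
  · exact ⟨kc, e₀.1, rfl⟩
  · exact ⟨kc, e₀.2, rfl⟩

/-- **A connector has at most two (hence three) neighbours**: the entry corner of its cell and
the exit corner of the previous cell. [folklore] -/
theorem length_le_three_of_adj_conn {kc : ℕ} (hk : kc < ncells ψ) {l : List ℕ} (hl : l.Nodup)
    (h : ∀ w ∈ l, (graphOf ψ).Adj (conn kc) w) : l.length ≤ 3 := by
  have hvalid := valid ψ (ngadgets ψ)
  have hcV : conn kc ∈ chainVerts (cellsOf ψ) := GridCell.conn_mem_chainVerts (by rwa [length_cellsOf])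
  set cands : List ℕ := [vtx kc (cellTy (cellsOf ψ) kc).pIdx, vtx (kc - 1) (cellTy (cellsOf ψ) (kc - 1)).qIdx]
  have hsub : ∀ w ∈ l, w ∈ cands := by
    intro w hw
    have hadj := h w hw
    change (GadgetFamily.graphUpTo (chainG (cellsOf ψ)) (chainVerts (cellsOf ψ)) (family ψ) (ngadgets ψ)).Adj (conn kc) w at hadj
    rcases hadj with ⟨hM, -, -, -⟩ | ⟨g, hg, hadj'⟩
    · rcases GridCell.adj_conn_iff.1 hM with ⟨-, rfl⟩ | ⟨-, -, rfl⟩ <;> simp [cands]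
    · exfalso
      obtain ⟨-, hc, -⟩ := hvalid.gadget_adj g hg _ _ hadj'
      rcases hc with hc | hc
      · exact Finset.disjoint_left.1 (hvalid.V_disjoint g hg) hcV hc
      · obtain ⟨kc', a, hka⟩ := exists_eq_vtx_of_mem_ports ψ hc
        exact GridCell.vtx_ne_conn kc' kc a hka.symm
  exact ((List.subperm_of_subset hl hsub).length_le).trans (by simp [cands])

/-- The cell neighbours of local vertex `j`, the number of them is the cell-degree. [folklore] -/
theorem length_filter_adjB (ty : CellTy) (j : Fin 16) :
    (ty.vertList.filter fun b => ty.adjB j b).length = ty.degree j := by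
  revert j; cases ty <;> decide

/-- **The chain neighbours of a block vertex**: cell neighbours, the connector before an entry
corner, the connector after an exit corner. [folklore] -/
def chainNbrs (kc : ℕ) (j : Fin 16) : List ℕ :=
  ((cellTyAt ψ kc).vertList.filter fun b => (cellTyAt ψ kc).adjB j b).map (vtx kc) ++
    ((if j = (cellTyAt ψ kc).pIdx then [conn kc] else []) ++
      (if j = (cellTyAt ψ kc).qIdx then [conn (kc + 1)] else []))

/-- The chain neighbour list has at most three members (cell-degree at most three, two at the
corners). [folklore] -/
theorem length_chainNbrs_le (kc : ℕ) (j : Fin 16) : (chainNbrs ψ kc j).length ≤ 3 := by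
  unfold chainNbrs
  rw [List.length_append, List.length_append, List.length_map, length_filter_adjB]
  have h3 := (cellTyAt ψ kc).degree_le_three j
  have hpq := (cellTyAt ψ kc).degree_pq
  have hne := (cellTyAt ψ kc).pIdx_ne_qIdx
  by_cases hp : j = (cellTyAt ψ kc).pIdx
  · rw [if_pos hp, if_neg (by rw [hp]; exact hne)]
    rw [hp, hpq.1]
    simp
  · rw [if_neg hp]
    by_cases hq : j = (cellTyAt ψ kc).qIdx
    · rw [if_pos hq, hq, hpq.2]; simp
    · rw [if_neg hq]; simpa using h3

/-- Every chain neighbour of a block vertex of an existing cell is in the list. [folklore] -/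
theorem mem_chainNbrs_of_adj {kc : ℕ} (hk : kc < ncells ψ) {j : Fin 16} {w : ℕ}
    (h : (chainG (cellsOf ψ)).Adj (vtx kc j) w) : w ∈ chainNbrs ψ kc j := by
  have hlen : kc < (cellsOf ψ).length := by rwa [length_cellsOf]
  obtain ⟨-, hw⟩ := GridCell.mem_chainVerts_of_adj h
  obtain ⟨i, hi, rfl | ⟨b, -, rfl⟩⟩ := GridCell.eq_conn_or_eq_vtx_of_mem hw
  · rcases GridCell.adj_vtx_conn_iff.1 h with ⟨rfl, -, hj⟩ | ⟨rfl, -, hj⟩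
    · rw [cellTy_cellsOf ψ hk] at hj
      unfold chainNbrs; simp [hj]
    · rw [cellTy_cellsOf ψ hk] at hj
      unfold chainNbrs; simp [hj]
  · obtain ⟨rfl, -, hadj⟩ := GridCell.adj_vtx_vtx_iff.1 h
    rw [cellTy_cellsOf ψ hk] at hadj
    unfold chainNbrs
    refine List.mem_append.2 (Or.inl (List.mem_map_of_mem ?_))
    exact List.mem_filter.2 ⟨((cellTyAt ψ kc).mem_vertList_of_adjB _ _ hadj).2, hadj⟩

/-- **A block vertex has at most three neighbours.** [folklore] -/
theorem length_le_three_of_adj_vtx {kc : ℕ} (hk : kc < ncells ψ) (j : Fin 16) {l : List ℕ} (hl : l.Nodup)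
    (h : ∀ w ∈ l, (graphOf ψ).Adj (vtx kc j) w) : l.length ≤ 3 := by
  classical
  have hvalid := valid ψ (ngadgets ψ)
  set v := vtx kc j with hv
  -- split the neighbours into chain neighbours (non-slot) and gadget neighbours
  have hcases : ∀ w ∈ l, ((chainG (cellsOf ψ)).Adj v w ∧ ∀ g < ngadgets ψ, ¬ slotOf ((family ψ).S g) v w) ∨
      ∃ g < ngadgets ψ, ((family ψ).GX g).Adj v w ∧ v ∈ ports ((family ψ).S g) := by
    intro w hw
    have hadj := h w hw
    change (GadgetFamily.graphUpTo (chainG (cellsOf ψ)) (chainVerts (cellsOf ψ)) (family ψ) (ngadgets ψ)).Adj v w at hadj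
    rcases hadj with ⟨hM, -, -, hns⟩ | ⟨g, hg, hadj'⟩
    · exact Or.inl ⟨hM, hns⟩
    · refine Or.inr ⟨g, hg, hadj', ?_⟩
      obtain ⟨-, hc, -⟩ := hvalid.gadget_adj g hg _ _ hadj'
      rcases hc with hc | hc
      · exact absurd (mem_VX_bounds ψ hc).1 (not_le.2 (vtx_lt_gbase ψ hk j g))
      · exact hc
  let lc := l.filter fun w => decide ((chainG (cellsOf ψ)).Adj v w ∧ ∀ g < ngadgets ψ, ¬ slotOf ((family ψ).S g) v w)
  let lg := l.filter fun w => ¬ decide ((chainG (cellsOf ψ)).Adj v w ∧ ∀ g < ngadgets ψ, ¬ slotOf ((family ψ).S g) v w)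
  have hlen : l.length = lc.length + lg.length := by
    have := List.length_eq_countP_add_countP (l := l) (fun w => decide ((chainG (cellsOf ψ)).Adj v w ∧ ∀ g < ngadgets ψ, ¬ slotOf ((family ψ).S g) v w))
    simpa [lc, lg, List.countP_eq_length_filter] using this
  -- the gadget of a gadget neighbour, and the other end of the slot through `v`
  have hgad : ∀ w ∈ lg, ∃ g < ngadgets ψ, ((family ψ).GX g).Adj v w ∧ ∃ e ∈ (family ψ).S g, v = e.1 ∨ v = e.2 := by
    intro w hw
    obtain ⟨hwl, hneg⟩ := List.mem_filter.1 hw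
    rcases hcases w hwl with hc | ⟨g, hg, hadj', hp⟩
    · simp only [decide_eq_true_eq] at hneg
      exact absurd hc hneg
    · exact ⟨g, hg, hadj', mem_ports_iff.1 hp⟩
  choose! gadOf hgadOf using hgad
  -- partner: the other end of the slot of `gadOf w` through `v`
  have hslot : ∀ w ∈ lg, ∃ p, slotOf ((family ψ).S (gadOf w)) v p := by
    intro w hw
    obtain ⟨-, -, e, he, h | h⟩ := hgadOf w hw
    · exact ⟨e.2, Or.inl (by rw [h]; simpa using he)⟩
    · exact ⟨e.1, Or.inr (by rw [h]; simpa using he)⟩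
  choose! partner hpartner using hslot
  -- the partner is a chain neighbour excluded from `lc`, and the map is injective on `lg`
  have hpartner_adj : ∀ w ∈ lg, (chainG (cellsOf ψ)).Adj v (partner w) := by
    intro w hw
    rcases hpartner w hw with hs | hs
    · exact (hvalid.slot_adj _ (hgadOf w hw).1 _ hs).2.2
    · exact ((hvalid.slot_adj _ (hgadOf w hw).1 _ hs).2.2).symm
  have hpartner_not : ∀ w ∈ lg, partner w ∉ lc := by
    intro w hw hmem
    obtain ⟨-, hdec⟩ := List.mem_filter.1 hmem
    simp only [decide_eq_true_eq] at hdec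
    exact hdec.2 _ (hgadOf w hw).1 (hpartner w hw)
  have hgad_inj : ∀ w ∈ lg, ∀ w' ∈ lg, gadOf w = gadOf w' → w = w' := by
    intro w hw w' hw' hg
    obtain ⟨hlt, hadj, e, he, hve⟩ := hgadOf w hw
    obtain ⟨-, hadj', -⟩ := hgadOf w' hw'
    rw [← hg] at hadj'
    have hp : v ∈ ports ((family ψ).S (gadOf w)) := mem_ports_iff.2 ⟨e, he, hve⟩
    exact hvalid.port_unique _ hlt v hp w w' hadj hadj'
  have hpartner_inj : ∀ w ∈ lg, ∀ w' ∈ lg, partner w = partner w' → w = w' := by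
    intro w hw w' hw' hpp
    refine hgad_inj w hw w' hw' ?_
    by_contra hne
    -- the slot of `gadOf w` through `v` and `partner w` is also a slot of `gadOf w'`: across gadgets, impossible
    have hs := hpartner w hw
    have hs' := hpartner w' hw'
    rw [← hpp] at hs'
    rcases hs with hs | hs
    · exact hvalid.slot_across _ (hgadOf w hw).1 _ (hgadOf w' hw').1 hne _ hs hs'
    · have := hvalid.slot_across _ (hgadOf w hw).1 _ (hgadOf w' hw').1 hne _ hs
      exact this (slotOf_comm.1 hs')
  -- count: `lc` and the partners of `lg` are distinct chain neighbours
  have hnd_lc : lc.Nodup := hl.filter _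
  have hnd_lg : lg.Nodup := hl.filter _
  have hall : ∀ x ∈ lc ++ lg.map partner, x ∈ chainNbrs ψ kc j := by
    intro x hx
    rcases List.mem_append.1 hx with hx | hx
    · obtain ⟨-, hdec⟩ := List.mem_filter.1 hx
      simp only [decide_eq_true_eq] at hdec
      exact mem_chainNbrs_of_adj ψ hk hdec.1
    · obtain ⟨w, hw, rfl⟩ := List.mem_map.1 hx
      exact mem_chainNbrs_of_adj ψ hk (hpartner_adj w hw)
  have hnd : (lc ++ lg.map partner).Nodup := by
    refine List.nodup_append.2 ⟨hnd_lc, ?_, fun x hx y hy => ?_⟩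
    · exact hnd_lg.map_on fun w hw w' hw' h => hpartner_inj w hw w' hw' h
    · rintro rfl
      obtain ⟨w, hw, rfl⟩ := List.mem_map.1 hy
      exact hpartner_not w hw hx
  have := ((List.subperm_of_subset hnd hall).length_le).trans (length_chainNbrs_le ψ kc j)
  rw [List.length_append, List.length_map] at this
  omega

/-- **Every vertex of the grid graph of a formula has at most three neighbours.**
[cite: LiskiewiczOgiharaToda2003, §4 (proof of Theorem 7: maximum degree three)] -/
theorem length_le_three_of_adj (v : ℕ) {l : List ℕ} (hl : l.Nodup) (h : ∀ w ∈ l, (graphOf ψ).Adj v w) : l.length ≤ 3 := by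
  by_cases hl0 : l = []
  · simp [hl0]
  obtain ⟨w₀, hw₀⟩ := List.exists_mem_of_ne_nil l hl0
  have hv : v ∈ vertsOf ψ := (mem_vertsOf_of_adj ψ (h w₀ hw₀)).1
  change v ∈ GadgetFamily.vertsUpTo (chainVerts (cellsOf ψ)) (family ψ) (ngadgets ψ) at hv
  rcases GadgetFamily.mem_vertsUpTo_iff.1 hv with hv | ⟨g, hg, hv⟩
  · obtain ⟨kc, hk, rfl | ⟨j, -, rfl⟩⟩ := GridCell.eq_conn_or_eq_vtx_of_mem hv
    · rw [length_cellsOf] at hk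
      exact length_le_three_of_adj_conn ψ hk hl h
    · rw [length_cellsOf] at hk
      exact length_le_three_of_adj_vtx ψ hk j hl h
  · exact length_le_three_of_adj_VX ψ hg hv hl h

end GridFormulaFP

end Literature.Barriers.CriticalPhenomena.GridSAW
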